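import Mathlib.Analysis.SpecialFunctions.Pow.Real
import Mathlib.Analysis.SpecialFunctions.Log.Basic
import Mathlib.Analysis.Complex.ExponentialBounds
import Mathlib.Analysis.SpecificLimits.Basic
import Literature.Computability.Complexity.AOWLevelFailure
import HarnessLib

/-!
# Asymptotics of the level tests under `m̄ ≥ n^{k/2} (log n)^4`: the AOW refuter accepts w.h.p.
(Allen–O'Donnell–Witmer 2015, Thm. 2.3 for `P = OR_k`: the probabilistic half)

Trunk T-CPLX-CORE (Literature/Computability/Complexity). Support file for the discharge of the
named fact `allen_odonnell_witmer_kSAT` (`AOWRefutation.lean`), probabilistic part X (final).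

For a sequence of inclusion probabilities `p : ℕ → [0,1]` with EVENTUALLY
`n^{k/2} (log n)^4 ≤ 2^k n^k p(n) = m̄(n)` (the hypothesis of `allen_odonnell_witmer_kSAT` with
`C = 1`, `c = 4`) and the refuter's exponent `q = 2^{aowTraceExp k n}`:

* elementary limits: `eventually_le_log`, `tendsto_const_div_log_pow` (`K/(log n)^j → 0`);
* the trace exponent in reals: `two_pow_aowTraceExp_le_log` (`q ≤ 32 k log n`),
  `pow_four_mul_le_two_pow_aowTraceExp` (`n^{4k} ≤ 2^q`);
* consequences of the hypothesis: `pow_mul_log_le_of_hyp` (`n^a (log n)^4 ≤ m̄` for `2a ≤ k`),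
  `pow_mul_log_sq_le_of_hyp` (`n^k (log n)^8 ≤ m̄²`);
* the algebra of the two Markov ratios of `AOWLevelFailure.lean`: `level_ratio_le` (`≤ 1/n` once
  `m̄ ≥ 32 q² 4^k n^a` and `n^{b+1} ≤ 2^q`), `odd_ratio_le` (`≤ 1/n` once `X ≥ 2^{4k+17} q^6` and
  `n^{4r+1} ≤ 2^q`);
* **each fixed test fails with vanishing probability**: `tendsto_subsetProb_not_levelCheck`
  (`P[¬LevelCheck] ≤ 5/n` eventually), `tendsto_subsetProb_not_oddCheck`
  (`P[¬OddCheck] ≤ 5/n + 8·4^k/(log n)^4` eventually);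
* **the refuter accepts with probability `→ 1`**: `tendsto_subsetProb_aowAccepts` (union bound over
  the finitely many, `n`-independent, tests of `AOWAccepts k n (aowTraceExp k n)`).

## References

* S. R. Allen, R. O'Donnell, D. Witmer, *How to refute a random CSP*, FOCS 2015,
  arXiv:1505.04383, Thm. 2.3 (with Def. 3.7: `Pr[fail] = o(1)`), App. A.1, A.2, A.4 (choice
  `r = Θ(log n)`, Remark A.3).
-/

noncomputable section

namespace Literature.Computability.Complexity

open Finset Filter Topology

/-! ### Elementary asymptotics -/

/-- `log n → ∞` along the naturals: eventually `K ≤ log n`. [folklore] -/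
theorem eventually_le_log (K : ℝ) : ∀ᶠ n : ℕ in atTop, K ≤ Real.log n :=
  (Real.tendsto_log_atTop.comp tendsto_natCast_atTop_atTop).eventually_ge_atTop K

/-- `K / (log n)^j → 0` for `j ≥ 1`. (Twin, outside this file's import cone:
`Literature.NumberTheory.Sieve.tendsto_const_div_log_pow_atTop`.) [folklore] -/
theorem tendsto_const_div_log_pow (K : ℝ) {j : ℕ} (hj : 1 ≤ j) :
    Tendsto (fun n : ℕ => K / Real.log n ^ j) atTop (𝓝 0) := by
  have hlog : Tendsto (fun n : ℕ => Real.log n ^ j) atTop atTop :=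
    (tendsto_pow_atTop (by omega)).comp (Real.tendsto_log_atTop.comp tendsto_natCast_atTop_atTop)
  simpa [div_eq_mul_inv] using hlog.inv_tendsto_atTop.const_mul K

/-- The trace exponent in reals: `q ≤ 32 k log n` for `n ≥ 2`, `k ≥ 1`, where `q = 2^{aowTraceExp k n}`.
[Allen–O'Donnell–Witmer 2015, App. A.4 (`r = Θ(log n)`)] [folklore] -/
theorem two_pow_aowTraceExp_le_log {k n : ℕ} (hk : 1 ≤ k) (hn : 2 ≤ n) :
    ((2 ^ aowTraceExp k n : ℕ) : ℝ) ≤ 32 * k * Real.log n := by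
  have h1 := two_pow_aowTraceExp_le (n := n) hk
  have hL : (Nat.log 2 n : ℝ) * Real.log 2 ≤ Real.log n := by
    have h2 : (2 : ℝ) ^ Nat.log 2 n ≤ n := by
      exact_mod_cast Nat.pow_log_le_self 2 (by omega : n ≠ 0)
    have := Real.log_le_log (by positivity) h2
    rwa [Real.log_pow] at this
  have hlog2 : (1 : ℝ) / 2 < Real.log 2 := by
    have := Real.log_two_gt_d9
    norm_num at this ⊢
    linarith
  have hlogn : Real.log 2 ≤ Real.log n := Real.log_le_log (by norm_num) (by exact_mod_cast hn)
  have hL' : (Nat.log 2 n : ℝ) + 1 ≤ 4 * Real.log n := by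
    -- `L ≤ log n / log 2 ≤ 2 log n` and `1 ≤ 2 log n`
    have hLle : (Nat.log 2 n : ℝ) ≤ 2 * Real.log n := by
      have hpos : 0 < Real.log 2 := by linarith
      have : (Nat.log 2 n : ℝ) ≤ Real.log n / Real.log 2 := by rw [le_div_iff₀ hpos]; exact hL
      refine this.trans ?_
      rw [div_le_iff₀ hpos]
      nlinarith
    nlinarith
  calc ((2 ^ aowTraceExp k n : ℕ) : ℝ) ≤ ((8 * k * (Nat.log 2 n + 1) : ℕ) : ℝ) := by exact_mod_cast h1
    _ = 8 * k * ((Nat.log 2 n : ℝ) + 1) := by push_cast; ring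
    _ ≤ 8 * k * (4 * Real.log n) := by
        apply mul_le_mul_of_nonneg_left hL'
        positivity
    _ = 32 * k * Real.log n := by ring

/-- The trace exponent beats every fixed polynomial: `n^{4k} ≤ 2^q` (`q = 2^{aowTraceExp k n}`).
[Allen–O'Donnell–Witmer 2015, App. A.4 (`r = Θ(log n)` large enough)] [folklore] -/
theorem pow_four_mul_le_two_pow_aowTraceExp (k n : ℕ) : n ^ (4 * k) ≤ 2 ^ 2 ^ aowTraceExp k n := by
  have hq := lt_two_pow_aowTraceExp k n
  have hn : n < 2 ^ (Nat.log 2 n + 1) := Nat.lt_pow_succ_log_self (by norm_num) n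
  calc n ^ (4 * k) ≤ (2 ^ (Nat.log 2 n + 1)) ^ (4 * k) := Nat.pow_le_pow_left hn.le _
    _ = 2 ^ (4 * k * (Nat.log 2 n + 1)) := by rw [← pow_mul]; ring_nf
    _ ≤ 2 ^ 2 ^ aowTraceExp k n := Nat.pow_le_pow_right (by norm_num) hq.le

/-! ### Consequences of the hypothesis `n^{k/2} (log n)^4 ≤ m̄` -/

variable {k : ℕ}

/-- The expected number of constraints `m̄ = |AOWConstraint k n| · p = 2^k n^k p`. [Allen–O'Donnell–Witmer
2015, §3.1] [folklore] -/
theorem card_AOWConstraint_mul (n : ℕ) (p : ℝ) :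
    (Fintype.card (AOWConstraint k n) : ℝ) * p = 2 ^ k * (n : ℝ) ^ k * p := by
  rw [card_AOWConstraint]
  push_cast
  ring

/-- From `n^{k/2} (log n)^4 ≤ m̄` and `2a ≤ k`: `n^a (log n)^4 ≤ m̄` (for `n ≥ 1`). [folklore] -/
theorem pow_mul_log_le_of_hyp {n a : ℕ} (hn : 1 ≤ n) (ha : 2 * a ≤ k) {mbar : ℝ}
    (h : (n : ℝ) ^ ((k : ℝ) / 2) * Real.log n ^ (4 : ℝ) ≤ mbar) :
    (n : ℝ) ^ a * Real.log n ^ 4 ≤ mbar := by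
  have hn1 : (1 : ℝ) ≤ n := by exact_mod_cast hn
  have hlog : Real.log n ^ (4 : ℝ) = Real.log n ^ 4 := by
    rw [show (4 : ℝ) = ((4 : ℕ) : ℝ) by norm_num, Real.rpow_natCast]
  rw [hlog] at h
  refine le_trans (mul_le_mul_of_nonneg_right ?_ (by positivity)) h
  rw [← Real.rpow_natCast]
  exact Real.rpow_le_rpow_of_exponent_le hn1 (by
    rw [le_div_iff₀ (by norm_num : (0 : ℝ) < 2)]
    exact_mod_cast (by omega : a * 2 ≤ k))

/-- From `n^{k/2} (log n)^4 ≤ m̄`: `n^k (log n)^8 ≤ m̄²`. [folklore] -/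
theorem pow_mul_log_sq_le_of_hyp {n : ℕ} {mbar : ℝ}
    (h : (n : ℝ) ^ ((k : ℝ) / 2) * Real.log n ^ (4 : ℝ) ≤ mbar) :
    (n : ℝ) ^ k * Real.log n ^ 8 ≤ mbar ^ 2 := by
  have hlog4 : Real.log n ^ (4 : ℝ) = Real.log n ^ 4 := by
    rw [show (4 : ℝ) = ((4 : ℕ) : ℝ) by norm_num, Real.rpow_natCast]
  rw [hlog4] at h
  have h0 : 0 ≤ (n : ℝ) ^ ((k : ℝ) / 2) * Real.log n ^ 4 := by positivity
  have hsq := pow_le_pow_left₀ h0 h 2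
  have hn2 : ((n : ℝ) ^ ((k : ℝ) / 2)) ^ 2 = (n : ℝ) ^ k := by
    rw [← Real.rpow_natCast ((n : ℝ) ^ ((k : ℝ) / 2)) 2, ← Real.rpow_mul (by positivity),
      show (k : ℝ) / 2 * ((2 : ℕ) : ℝ) = ((k : ℕ) : ℝ) by push_cast; ring, Real.rpow_natCast]
  calc (n : ℝ) ^ k * Real.log n ^ 8 = ((n : ℝ) ^ ((k : ℝ) / 2)) ^ 2 * (Real.log n ^ 4) ^ 2 := by
        rw [hn2]; ring
    _ = ((n : ℝ) ^ ((k : ℝ) / 2) * Real.log n ^ 4) ^ 2 := by ring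
    _ ≤ mbar ^ 2 := hsq

/-! ### The balanced level tests -/

/-- **The algebra of the even ratio**: with `W = p · 2^k n^{k-b} ≥ 1`, `m̄ = W n^b`,
`m̄ ≥ 32 q² 4^k n^a` and `n^{b+1} ≤ 2^q`, the Markov ratio of `subsetProb_not_levelCheck_le` is at
most `1/n`. [Allen–O'Donnell–Witmer 2015, App. A.1/A.4 (choice of `r`)] [folklore] -/
theorem level_ratio_le {n a b q : ℕ} (hn : 1 ≤ n) (hq : 1 ≤ q) {p M : ℝ}
    (hM : M = 2 ^ k * (n : ℝ) ^ (k - b) * (n : ℝ) ^ b) (hW : 1 ≤ p * ((n : ℝ) ^ (k - b) * 2 ^ k))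
    (hbig : 32 * (q : ℝ) ^ 2 * 4 ^ k * (n : ℝ) ^ a ≤ M * p)
    (hpow : (n : ℝ) ^ (b + 1) ≤ 2 ^ q) :
    (M * ((q * 2 : ℕ) : ℝ) ^ (q * 2 - 1) * p * ((q : ℕ) * max 1 ((p * ((n : ℝ) ^ (k - b) * 2 ^ k)) ^ (q - 1)))) /
        ((M * p / 2) ^ (2 * q) / (((2 : ℝ) ^ k) ^ (2 * q) * (((n : ℝ) ^ a) ^ q * ((n : ℝ) ^ b) ^ q))) ≤
      1 / n := by
  set W := p * ((n : ℝ) ^ (k - b) * 2 ^ k) with hWdef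
  have hn0 : (0 : ℝ) < n := by exact_mod_cast hn
  have hW0 : 0 < W := lt_of_lt_of_le one_pos hW
  have hMp : M * p = W * (n : ℝ) ^ b := by rw [hM, hWdef]; ring
  have hmax : max 1 ((p * ((n : ℝ) ^ (k - b) * 2 ^ k)) ^ (q - 1)) = W ^ (q - 1) :=
    max_eq_right (one_le_pow₀ hW)
  have hK : 0 < ((2 : ℝ) ^ k) ^ (2 * q) * (((n : ℝ) ^ a) ^ q * ((n : ℝ) ^ b) ^ q) := by positivity
  have hθ : 0 < (M * p / 2) ^ (2 * q) / (((2 : ℝ) ^ k) ^ (2 * q) * (((n : ℝ) ^ a) ^ q * ((n : ℝ) ^ b) ^ q)) := by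
    rw [hMp]; positivity
  rw [hmax, div_le_div_iff₀ hθ hn0, one_mul, le_div_iff₀ hK]
  -- everything in terms of `W`, `n`, `q`
  have hq2 : ((q * 2 : ℕ) : ℝ) ^ (q * 2 - 1) * (q : ℕ) ≤ (2 * (q : ℝ)) ^ (2 * q) := by
    have hqq : (q : ℝ) ≤ 2 * q := by linarith [show (0 : ℝ) ≤ q from by positivity]
    calc ((q * 2 : ℕ) : ℝ) ^ (q * 2 - 1) * (q : ℕ) ≤ ((q * 2 : ℕ) : ℝ) ^ (q * 2 - 1) * (2 * q) := by
          apply mul_le_mul_of_nonneg_left _ (by positivity)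
          exact_mod_cast (by omega : q ≤ 2 * q)
      _ = (2 * (q : ℝ)) ^ (2 * q) := by
          have : ((q * 2 : ℕ) : ℝ) = 2 * q := by push_cast; ring
          rw [this, ← pow_succ, show q * 2 - 1 + 1 = 2 * q by omega]
  -- the main inequality
  have hstep5 : (2 * (4 * (q : ℝ) ^ 2 * 4 ^ k * (n : ℝ) ^ a)) ^ q ≤ (W * (n : ℝ) ^ b / 4) ^ q := by
    refine pow_le_pow_left₀ (by positivity) ?_ q
    rw [le_div_iff₀ (by norm_num : (0 : ℝ) < 4), ← hMp]
    linarith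
  calc M * ((q * 2 : ℕ) : ℝ) ^ (q * 2 - 1) * p * ((q : ℕ) * W ^ (q - 1)) * n *
        (((2 : ℝ) ^ k) ^ (2 * q) * (((n : ℝ) ^ a) ^ q * ((n : ℝ) ^ b) ^ q))
      = (((q * 2 : ℕ) : ℝ) ^ (q * 2 - 1) * (q : ℕ)) * ((W * W ^ (q - 1)) * ((n : ℝ) ^ b * n) *
          (((2 : ℝ) ^ k) ^ (2 * q) * (((n : ℝ) ^ a) ^ q * ((n : ℝ) ^ b) ^ q))) := by
        rw [show M * ((q * 2 : ℕ) : ℝ) ^ (q * 2 - 1) * p = ((q * 2 : ℕ) : ℝ) ^ (q * 2 - 1) * (M * p) by ring,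
          hMp]
        ring
    _ ≤ (2 * (q : ℝ)) ^ (2 * q) * ((W * W ^ (q - 1)) * ((n : ℝ) ^ b * n) *
          (((2 : ℝ) ^ k) ^ (2 * q) * (((n : ℝ) ^ a) ^ q * ((n : ℝ) ^ b) ^ q))) :=
        mul_le_mul_of_nonneg_right hq2 (by positivity)
    _ = (4 * (q : ℝ) ^ 2 * 4 ^ k * (n : ℝ) ^ a) ^ q * (n : ℝ) ^ (b + 1) * (W ^ q * ((n : ℝ) ^ b) ^ q) := by
        have hWq : W * W ^ (q - 1) = W ^ q := by
          rw [← pow_succ', Nat.sub_add_cancel hq]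
        rw [hWq, show (2 * (q : ℝ)) ^ (2 * q) = (4 * (q : ℝ) ^ 2) ^ q by rw [pow_mul]; ring_nf,
          show ((2 : ℝ) ^ k) ^ (2 * q) = ((4 : ℝ) ^ k) ^ q by
            rw [← pow_mul, show k * (2 * q) = 2 * k * q by ring, pow_mul, pow_mul]; norm_num,
          pow_succ, mul_pow, mul_pow, mul_pow]
        ring
    _ ≤ (4 * (q : ℝ) ^ 2 * 4 ^ k * (n : ℝ) ^ a) ^ q * 2 ^ q * (W ^ q * ((n : ℝ) ^ b) ^ q) :=
        mul_le_mul_of_nonneg_right (mul_le_mul_of_nonneg_left hpow (by positivity)) (by positivity)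
    _ = (2 * (4 * (q : ℝ) ^ 2 * 4 ^ k * (n : ℝ) ^ a)) ^ q * (W ^ q * ((n : ℝ) ^ b) ^ q) := by
        rw [mul_pow (2 : ℝ)]
        ring
    _ ≤ (W * (n : ℝ) ^ b / 4) ^ q * (W ^ q * ((n : ℝ) ^ b) ^ q) :=
        mul_le_mul_of_nonneg_right hstep5 (by positivity)
    _ = (M * p / 2) ^ (2 * q) := by
        rw [hMp, ← mul_pow, ← mul_pow, pow_mul]
        congr 1
        ring


/-! ### The odd test -/

/-- **The algebra of the odd ratio** (`k = 2r+1`, `N = n^r`, `X = N² n p²`, `m̄² = 4^k N² n X`):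
if `X ≥ 2^{4k+17} q^6` and `N^4 n ≤ 2^q` then the Markov ratio of the trace term of
`subsetProb_not_oddCheck_le` is at most `1/n`. [Allen–O'Donnell–Witmer 2015, App. A.2/A.4
(Lemma A.2 with `r = Θ(log n)`)] [folklore] -/
theorem odd_ratio_le {n r q : ℕ} (hn : 1 ≤ n) (hq : 1 ≤ q) {p M X : ℝ} (hX0 : 0 < X)
    (hX : X = ((n : ℝ) ^ r) ^ 2 * n * p ^ 2)
    (hM2 : (M * p) ^ 2 = ((2 : ℝ) ^ k) ^ 2 * ((n : ℝ) ^ r) ^ 2 * n * X)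
    (hbig : (2 : ℝ) ^ 17 * ((2 : ℝ) ^ k) ^ 4 * (q : ℝ) ^ 6 ≤ X)
    (hpow : ((n : ℝ) ^ r) ^ 4 * n ≤ 2 ^ q) :
    (((2 : ℝ) ^ k) ^ (q * 2) * ((2 : ℝ) ^ k) ^ (q * 2) *
          ((((2 * q + 3) * q : ℕ)) * ((((q * 4 : ℕ)) : ℝ) ^ (q * 4 - 1) * (((q * 2 : ℕ)) : ℝ) ^ (q * 2 - 1)) *
            (((n : ℝ) ^ r) ^ 4 * (((n : ℝ) ^ r) ^ 2 * n * p ^ 2) ^ q))) /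
        (((M * p / 2) ^ 2) ^ (2 * q) /
          ((2 * 4 ^ k * (n : ℝ)) ^ (2 * q) * ((((n : ℝ) ^ r) ^ 2) ^ q * (((n : ℝ) ^ r) ^ 2) ^ q))) ≤
      1 / n := by
  set A : ℝ := (2 : ℝ) ^ k with hA
  set N : ℝ := (n : ℝ) ^ r with hN
  have hn0 : (0 : ℝ) < n := by exact_mod_cast hn
  have hA0 : 0 < A := by rw [hA]; positivity
  have hN0 : 0 < N := by rw [hN]; positivity
  have hMp0 : 0 < (M * p) ^ 2 := by rw [hM2]; positivity
  have hMp : M * p ≠ 0 := fun h => by rw [h] at hMp0; simp at hMp0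
  have h4 : (4 : ℝ) ^ k = A ^ 2 := by
    rw [hA, ← pow_mul, mul_comm, pow_mul]; norm_num
  rw [← hX, h4]
  have hK : 0 < (2 * A ^ 2 * (n : ℝ)) ^ (2 * q) * ((N ^ 2) ^ q * (N ^ 2) ^ q) := by positivity
  have hθ : 0 < ((M * p / 2) ^ 2) ^ (2 * q) / ((2 * A ^ 2 * (n : ℝ)) ^ (2 * q) * ((N ^ 2) ^ q * (N ^ 2) ^ q)) := by
    have : 0 < (M * p / 2) ^ 2 := by positivity
    positivity
  rw [div_le_div_iff₀ hθ hn0, one_mul, le_div_iff₀ hK]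
  -- the combinatorial factor
  have hcomb : ((((2 * q + 3) * q : ℕ)) : ℝ) * ((((q * 4 : ℕ)) : ℝ) ^ (q * 4 - 1) * (((q * 2 : ℕ)) : ℝ) ^ (q * 2 - 1)) ≤
      (4 * (q : ℝ)) ^ (4 * q) * (2 * (q : ℝ)) ^ (2 * q) := by
    have h1 : ((((2 * q + 3) * q : ℕ)) : ℝ) ≤ (4 * (q : ℝ)) * (2 * q) := by
      have : (2 * q + 3) * q ≤ (4 * q) * (2 * q) := by nlinarith
      exact_mod_cast this
    calc _ ≤ (4 * (q : ℝ)) * (2 * q) * ((((q * 4 : ℕ)) : ℝ) ^ (q * 4 - 1) * (((q * 2 : ℕ)) : ℝ) ^ (q * 2 - 1)) :=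
          mul_le_mul_of_nonneg_right h1 (by positivity)
      _ = (4 * (q : ℝ)) ^ (4 * q) * (2 * (q : ℝ)) ^ (2 * q) := by
          have e4 : ((((q * 4 : ℕ)) : ℝ)) = 4 * q := by push_cast; ring
          have e2 : ((((q * 2 : ℕ)) : ℝ)) = 2 * q := by push_cast; ring
          rw [e4, e2, show (4 * (q : ℝ)) * (2 * q) * ((4 * (q : ℝ)) ^ (q * 4 - 1) * (2 * (q : ℝ)) ^ (q * 2 - 1)) =
            ((4 * (q : ℝ)) ^ (q * 4 - 1) * (4 * q)) * ((2 * (q : ℝ)) ^ (q * 2 - 1) * (2 * q)) by ring,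
            ← pow_succ, ← pow_succ, show q * 4 - 1 + 1 = 4 * q by omega, show q * 2 - 1 + 1 = 2 * q by omega]
  -- the base of the `q`-th powers on the left
  set B : ℝ := A ^ 2 * A ^ 2 * ((4 * (q : ℝ)) ^ 4 * (2 * (q : ℝ)) ^ 2) * (2 * A ^ 2 * (n : ℝ)) ^ 2 * (N ^ 2 * N ^ 2)
    with hBdef
  have hB : B = 4096 * A ^ 8 * (q : ℝ) ^ 6 * (n : ℝ) ^ 2 * N ^ 4 := by rw [hBdef]; ring
  -- base inequality from `hbig`
  have hbase : 2 * B ≤ A ^ 4 * N ^ 4 * (n : ℝ) ^ 2 * X / 16 := by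
    rw [hB, le_div_iff₀ (by norm_num : (0 : ℝ) < 16)]
    have : 2 * (4096 * A ^ 8 * (q : ℝ) ^ 6 * (n : ℝ) ^ 2 * N ^ 4) * 16 =
        ((2 : ℝ) ^ 17 * A ^ 4 * (q : ℝ) ^ 6) * (A ^ 4 * N ^ 4 * (n : ℝ) ^ 2) := by norm_num; ring
    rw [this, show A ^ 4 * N ^ 4 * (n : ℝ) ^ 2 * X = X * (A ^ 4 * N ^ 4 * (n : ℝ) ^ 2) by ring]
    exact mul_le_mul_of_nonneg_right hbig (by positivity)
  have hstep : (2 * B) ^ q ≤ (A ^ 4 * N ^ 4 * (n : ℝ) ^ 2 * X / 16) ^ q :=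
    pow_le_pow_left₀ (by positivity) hbase q
  have hY2 : (M * p / 2) ^ 2 = A ^ 2 * N ^ 2 * n * X / 4 := by
    rw [div_pow, hM2]; ring
  calc A ^ (q * 2) * A ^ (q * 2) *
        ((((2 * q + 3) * q : ℕ)) * ((((q * 4 : ℕ)) : ℝ) ^ (q * 4 - 1) * (((q * 2 : ℕ)) : ℝ) ^ (q * 2 - 1)) *
          (N ^ 4 * X ^ q)) * n *
        ((2 * A ^ 2 * (n : ℝ)) ^ (2 * q) * ((N ^ 2) ^ q * (N ^ 2) ^ q))
      ≤ A ^ (q * 2) * A ^ (q * 2) * (((4 * (q : ℝ)) ^ (4 * q) * (2 * (q : ℝ)) ^ (2 * q)) * (N ^ 4 * X ^ q)) * n *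
        ((2 * A ^ 2 * (n : ℝ)) ^ (2 * q) * ((N ^ 2) ^ q * (N ^ 2) ^ q)) := by
        gcongr
    _ = B ^ q * X ^ q * (N ^ 4 * n) := by
        rw [show A ^ (q * 2) = (A ^ 2) ^ q by rw [mul_comm, pow_mul],
          show (4 * (q : ℝ)) ^ (4 * q) = ((4 * (q : ℝ)) ^ 4) ^ q by rw [pow_mul],
          show (2 * (q : ℝ)) ^ (2 * q) = ((2 * (q : ℝ)) ^ 2) ^ q by rw [pow_mul],
          show (2 * A ^ 2 * (n : ℝ)) ^ (2 * q) = ((2 * A ^ 2 * (n : ℝ)) ^ 2) ^ q by rw [pow_mul], hBdef]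
        set u : ℝ := 4 * (q : ℝ) with hu
        set v : ℝ := 2 * (q : ℝ) with hv
        set c : ℝ := 2 * A ^ 2 * (n : ℝ) with hc
        clear_value u v c
        rw [mul_pow, mul_pow, mul_pow, mul_pow, mul_pow]
        ring
    _ ≤ B ^ q * X ^ q * 2 ^ q := mul_le_mul_of_nonneg_left hpow (by positivity)
    _ = (2 * B) ^ q * X ^ q := by rw [mul_pow (2 : ℝ)]; ring
    _ ≤ (A ^ 4 * N ^ 4 * (n : ℝ) ^ 2 * X / 16) ^ q * X ^ q :=
        mul_le_mul_of_nonneg_right hstep (by positivity)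
    _ = ((M * p / 2) ^ 2) ^ (2 * q) := by
        rw [hY2, pow_mul, ← mul_pow]
        congr 1
        ring

/-! ### Each balanced level test fails with vanishing probability -/

/-- **A balanced level test fails with probability `≤ 5/n` eventually**, hence `→ 0`.
[Allen–O'Donnell–Witmer 2015, Thm. 2.3 / App. A.1, A.4] [cite: arXiv150504383, Thm. 2.3] -/
theorem tendsto_subsetProb_not_levelCheck {a b : ℕ} (f : Fin (a + b) → Fin k)
    (hf : Function.Injective f) (ha : 1 ≤ a) (hba : b ≤ a) (h2a : 2 * a ≤ k) {p : ℕ → ℝ}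
    (hp : ∀ n, 0 ≤ p n ∧ p n ≤ 1)
    (hH : ∀ᶠ n : ℕ in atTop, (n : ℝ) ^ ((k : ℝ) / 2) * Real.log n ^ (4 : ℝ) ≤ 2 ^ k * (n : ℝ) ^ k * p n) :
    Tendsto (fun n => subsetProb (AOWConstraint k n) (p n)
      (fun T => ¬ LevelCheck k n (aowTraceExp k n) T.toList f)) atTop (𝓝 0) := by
  have hk : 1 ≤ k := by omega
  have hb : b ≤ k := by omega
  -- the eventual bound `≤ 5/n`
  have hev : ∀ᶠ n : ℕ in atTop, subsetProb (AOWConstraint k n) (p n)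
      (fun T => ¬ LevelCheck k n (aowTraceExp k n) T.toList f) ≤ 5 / n := by
    filter_upwards [hH, eventually_ge_atTop 2, eventually_le_log ((2 : ℝ) ^ 15 * 4 ^ k * (k : ℝ) ^ 2)]
      with n hHn hn2 hlogK
    obtain ⟨hp0, hp1⟩ := hp n
    set q : ℕ := 2 ^ aowTraceExp k n with hqdef
    have hq1 : 1 ≤ q := Nat.one_le_two_pow
    have hn1 : 1 ≤ n := by omega
    have hn0 : (0 : ℝ) < n := by exact_mod_cast (by omega : 0 < n)
    have hK1 : (1 : ℝ) ≤ (2 : ℝ) ^ 15 * 4 ^ k * (k : ℝ) ^ 2 := by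
      have : (1 : ℝ) ≤ k := by exact_mod_cast hk
      have h4 : (1 : ℝ) ≤ 4 ^ k := one_le_pow₀ (by norm_num)
      nlinarith [show (1 : ℝ) ≤ 2 ^ 15 by norm_num]
    have hlog1 : 1 ≤ Real.log n := hK1.trans hlogK
    -- `m̄` and the hypothesis
    set mbar : ℝ := (Fintype.card (AOWConstraint k n) : ℝ) * p n with hmbar
    have hmbar' : mbar = 2 ^ k * (n : ℝ) ^ k * p n := card_AOWConstraint_mul n (p n)
    have hHa : (n : ℝ) ^ a * Real.log n ^ 4 ≤ mbar := hmbar' ▸ pow_mul_log_le_of_hyp hn1 h2a hHn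
    have hH1 : (n : ℝ) ^ 1 * Real.log n ^ 4 ≤ mbar := hmbar' ▸ pow_mul_log_le_of_hyp hn1 (by omega) hHn
    have hmn : (n : ℝ) ≤ mbar := by
      have : (n : ℝ) ^ 1 * 1 ≤ (n : ℝ) ^ 1 * Real.log n ^ 4 :=
        mul_le_mul_of_nonneg_left (one_le_pow₀ hlog1) (by positivity)
      rw [pow_one, mul_one] at this
      exact this.trans (by simpa using hH1)
    have hm0 : 0 < mbar := hn0.trans_le hmn
    -- `q ≤ 32 k log n`, so `32 q² 4^k ≤ (log n)^4`
    have hqlog : (q : ℝ) ≤ 32 * k * Real.log n := two_pow_aowTraceExp_le_log hk hn2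
    have hq4 : 32 * (q : ℝ) ^ 2 * 4 ^ k ≤ Real.log n ^ 4 := by
      have hq2 : (q : ℝ) ^ 2 ≤ (32 * k * Real.log n) ^ 2 := pow_le_pow_left₀ (by positivity) hqlog 2
      calc 32 * (q : ℝ) ^ 2 * 4 ^ k ≤ 32 * (32 * k * Real.log n) ^ 2 * 4 ^ k := by gcongr
        _ = ((2 : ℝ) ^ 15 * 4 ^ k * (k : ℝ) ^ 2) * Real.log n ^ 2 := by ring
        _ ≤ Real.log n * Real.log n * Real.log n ^ 2 := by
            apply mul_le_mul_of_nonneg_right _ (by positivity)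
            nlinarith
        _ = Real.log n ^ 4 := by ring
    have hbig : 32 * (q : ℝ) ^ 2 * 4 ^ k * (n : ℝ) ^ a ≤ (Fintype.card (AOWConstraint k n) : ℝ) * p n := by
      rw [← hmbar]
      calc 32 * (q : ℝ) ^ 2 * 4 ^ k * (n : ℝ) ^ a ≤ Real.log n ^ 4 * (n : ℝ) ^ a :=
            mul_le_mul_of_nonneg_right hq4 (by positivity)
        _ = (n : ℝ) ^ a * Real.log n ^ 4 := by ring
        _ ≤ mbar := hHa
    -- `W ≥ 1`
    have hM : (Fintype.card (AOWConstraint k n) : ℝ) = 2 ^ k * (n : ℝ) ^ (k - b) * (n : ℝ) ^ b := by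
      rw [card_AOWConstraint]
      push_cast
      rw [mul_assoc, ← pow_add, Nat.sub_add_cancel hb]
      ring
    have hW : 1 ≤ p n * ((n : ℝ) ^ (k - b) * 2 ^ k) := by
      have hWnb : p n * ((n : ℝ) ^ (k - b) * 2 ^ k) * (n : ℝ) ^ b = mbar := by rw [hmbar, hM]; ring
      have hnb : (n : ℝ) ^ b ≤ mbar := by
        calc (n : ℝ) ^ b ≤ (n : ℝ) ^ a := pow_le_pow_right₀ (by exact_mod_cast hn1) hba
          _ ≤ (n : ℝ) ^ a * Real.log n ^ 4 := le_mul_of_one_le_right (by positivity) (one_le_pow₀ hlog1)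
          _ ≤ mbar := hHa
      by_contra hlt
      push Not at hlt
      have : p n * ((n : ℝ) ^ (k - b) * 2 ^ k) * (n : ℝ) ^ b < 1 * (n : ℝ) ^ b :=
        mul_lt_mul_of_pos_right hlt (by positivity)
      linarith
    -- `n^{b+1} ≤ 2^q`
    have hpow : (n : ℝ) ^ (b + 1) ≤ 2 ^ q := by
      have h1 : n ^ (b + 1) ≤ n ^ (4 * k) := Nat.pow_le_pow_right hn1 (by omega)
      have h2 := pow_four_mul_le_two_pow_aowTraceExp k n
      exact_mod_cast h1.trans h2
    -- assemble
    have hfail := subsetProb_not_levelCheck_le (k := k) hn1 (aowTraceExp k n) f hf ha hba hp0 hp1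
      (by rwa [← hmbar])
    have hcast : ((n ^ (k - b) * 2 ^ k : ℕ) : ℝ) = (n : ℝ) ^ (k - b) * 2 ^ k := by push_cast; ring
    rw [hcast] at hfail
    have hratio := level_ratio_le (k := k) (a := a) hn1 hq1 hM hW hbig hpow
    refine hfail.trans ?_
    have h4m : 4 / ((Fintype.card (AOWConstraint k n) : ℝ) * p n) ≤ 4 / n := by
      rw [← hmbar]
      exact div_le_div_of_nonneg_left (by norm_num) hn0 hmn
    calc _ ≤ 4 / (n : ℝ) + 1 / n := add_le_add h4m hratio
      _ = 5 / n := by ring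
  refine tendsto_of_tendsto_of_tendsto_of_le_of_le' tendsto_const_nhds
    (tendsto_const_div_atTop_nhds_zero_nat 5) ?_ hev
  exact Eventually.of_forall fun n => subsetProb_nonneg _ _

/-! ### The odd test fails with vanishing probability -/

/-- **The odd test fails with probability `≤ 5/n + 8·4^k/(log n)^4` eventually**, hence `→ 0`
(`k = 2r+1`). [Allen–O'Donnell–Witmer 2015, Thm. 2.3 / App. A.2, A.4] [cite: arXiv150504383, Thm. 2.3] -/
theorem tendsto_subsetProb_not_oddCheck {r : ℕ} (hkr : k = r + r + 1) (hk3 : 3 ≤ k)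
    (f : Fin (r + r + 1) → Fin k) (hf : Function.Injective f) {p : ℕ → ℝ}
    (hp : ∀ n, 0 ≤ p n ∧ p n ≤ 1)
    (hH : ∀ᶠ n : ℕ in atTop, (n : ℝ) ^ ((k : ℝ) / 2) * Real.log n ^ (4 : ℝ) ≤ 2 ^ k * (n : ℝ) ^ k * p n) :
    Tendsto (fun n => subsetProb (AOWConstraint k n) (p n)
      (fun T => ¬ OddCheck k n (aowTraceExp k n) T.toList f)) atTop (𝓝 0) := by
  have hk : 1 ≤ k := by omega
  have hev : ∀ᶠ n : ℕ in atTop, subsetProb (AOWConstraint k n) (p n)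
      (fun T => ¬ OddCheck k n (aowTraceExp k n) T.toList f) ≤ 5 / n + 8 * 4 ^ k / Real.log n ^ 4 := by
    filter_upwards [hH, eventually_ge_atTop 2, eventually_le_log ((2 : ℝ) ^ (6 * k + 47) * (k : ℝ) ^ 6)]
      with n hHn hn2 hlogK
    obtain ⟨hp0, hp1⟩ := hp n
    set q : ℕ := 2 ^ aowTraceExp k n with hqdef
    have hq1 : 1 ≤ q := Nat.one_le_two_pow
    have hn1 : 1 ≤ n := by omega
    have hn0 : (0 : ℝ) < n := by exact_mod_cast (by omega : 0 < n)
    have hK1 : (1 : ℝ) ≤ (2 : ℝ) ^ (6 * k + 47) * (k : ℝ) ^ 6 := by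
      have : (1 : ℝ) ≤ k := by exact_mod_cast hk
      have h2 : (1 : ℝ) ≤ (2 : ℝ) ^ (6 * k + 47) := one_le_pow₀ (by norm_num)
      nlinarith [one_le_pow₀ (M₀ := ℝ) (a := (k : ℝ)) this (n := 6)]
    have hlog1 : 1 ≤ Real.log n := hK1.trans hlogK
    set mbar : ℝ := (Fintype.card (AOWConstraint k n) : ℝ) * p n with hmbar
    have hmbar' : mbar = 2 ^ k * (n : ℝ) ^ k * p n := card_AOWConstraint_mul n (p n)
    have hH1 : (n : ℝ) ^ 1 * Real.log n ^ 4 ≤ mbar := hmbar' ▸ pow_mul_log_le_of_hyp hn1 (by omega) hHn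
    have hH2 : (n : ℝ) ^ k * Real.log n ^ 8 ≤ mbar ^ 2 := hmbar' ▸ pow_mul_log_sq_le_of_hyp hHn
    have hmn : (n : ℝ) * Real.log n ^ 4 ≤ mbar := by simpa using hH1
    have hmn' : (n : ℝ) ≤ mbar := by
      have : (n : ℝ) * 1 ≤ (n : ℝ) * Real.log n ^ 4 :=
        mul_le_mul_of_nonneg_left (one_le_pow₀ hlog1) (by positivity)
      rw [mul_one] at this
      exact this.trans hmn
    have hm0 : 0 < mbar := hn0.trans_le hmn'
    -- `X = (n^r)² n p²`, `m̄² = 4^k (n^r)² n X`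
    set X : ℝ := ((n : ℝ) ^ r) ^ 2 * n * p n ^ 2 with hX
    have hnk : ((n : ℝ) ^ r) ^ 2 * n = (n : ℝ) ^ k := by rw [hkr]; ring
    have hM2 : (mbar) ^ 2 = ((2 : ℝ) ^ k) ^ 2 * ((n : ℝ) ^ r) ^ 2 * n * X := by
      rw [hmbar', hX]
      have : (2 ^ k * (n : ℝ) ^ k * p n) ^ 2 = (2 : ℝ) ^ k * 2 ^ k * ((n : ℝ) ^ k * (n : ℝ) ^ k) * p n ^ 2 := by ring
      rw [this, ← hnk]
      ring
    have hXlog : Real.log n ^ 8 ≤ ((2 : ℝ) ^ k) ^ 2 * X := by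
      -- from `n^k (log n)^8 ≤ m̄² = 4^k n^k X`
      have h := hH2
      rw [hM2, ← hnk] at h
      have hpos : (0 : ℝ) < ((n : ℝ) ^ r) ^ 2 * n := by positivity
      have : ((n : ℝ) ^ r) ^ 2 * n * Real.log n ^ 8 ≤ ((n : ℝ) ^ r) ^ 2 * n * (((2 : ℝ) ^ k) ^ 2 * X) := by
        calc _ ≤ _ := h
          _ = _ := by ring
      exact le_of_mul_le_mul_left this hpos
    -- `q ≤ 32 k log n` ⟹ `2^{4k+17} q^6 ≤ X`
    have hqlog : (q : ℝ) ≤ 32 * k * Real.log n := two_pow_aowTraceExp_le_log hk hn2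
    have hbig : (2 : ℝ) ^ 17 * ((2 : ℝ) ^ k) ^ 4 * (q : ℝ) ^ 6 ≤ X := by
      have hq6 : (q : ℝ) ^ 6 ≤ (32 * k * Real.log n) ^ 6 := pow_le_pow_left₀ (by positivity) hqlog 6
      have h4k : (0 : ℝ) < ((2 : ℝ) ^ k) ^ 2 := by positivity
      -- it suffices to compare after multiplying by `4^k = (2^k)^2`
      refine le_of_mul_le_mul_left ?_ h4k
      calc ((2 : ℝ) ^ k) ^ 2 * ((2 : ℝ) ^ 17 * ((2 : ℝ) ^ k) ^ 4 * (q : ℝ) ^ 6)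
          ≤ ((2 : ℝ) ^ k) ^ 2 * ((2 : ℝ) ^ 17 * ((2 : ℝ) ^ k) ^ 4 * (32 * k * Real.log n) ^ 6) := by gcongr
        _ = ((2 : ℝ) ^ (6 * k + 47) * (k : ℝ) ^ 6) * Real.log n ^ 6 := by
            rw [show (32 : ℝ) = 2 ^ 5 by norm_num]
            ring
        _ ≤ Real.log n * Real.log n * Real.log n ^ 6 := by
            apply mul_le_mul_of_nonneg_right _ (by positivity)
            nlinarith
        _ = Real.log n ^ 8 := by ring
        _ ≤ ((2 : ℝ) ^ k) ^ 2 * X := hXlog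
    have hX1 : 1 ≤ X := by
      have : (1 : ℝ) ≤ (2 : ℝ) ^ 17 * ((2 : ℝ) ^ k) ^ 4 * (q : ℝ) ^ 6 := by
        have hq' : (1 : ℝ) ≤ q := by exact_mod_cast hq1
        have h1 : (1 : ℝ) ≤ (2 : ℝ) ^ 17 := by norm_num
        have h2 : (1 : ℝ) ≤ ((2 : ℝ) ^ k) ^ 4 := one_le_pow₀ (one_le_pow₀ (by norm_num))
        have h3 : (1 : ℝ) ≤ (q : ℝ) ^ 6 := one_le_pow₀ hq'
        nlinarith [mul_le_mul h1 h2 (by norm_num) (by positivity)]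
      exact this.trans hbig
    have hX0 : 0 < X := one_pos.trans_le hX1
    have hpow : ((n : ℝ) ^ r) ^ 4 * n ≤ 2 ^ q := by
      have h1 : n ^ (4 * r + 1) ≤ n ^ (4 * k) := Nat.pow_le_pow_right hn1 (by omega)
      have h2 := pow_four_mul_le_two_pow_aowTraceExp k n
      have : (n : ℝ) ^ (4 * r + 1) ≤ 2 ^ q := by exact_mod_cast h1.trans h2
      calc ((n : ℝ) ^ r) ^ 4 * n = (n : ℝ) ^ (4 * r + 1) := by ring
        _ ≤ 2 ^ q := this
    -- assemble
    have hfail := subsetProb_not_oddCheck_le (k := k) hn1 hkr (aowTraceExp k n) f hf hp0 hp1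
      (by rwa [← hmbar]) (by rw [← hX]; exact hX1)
    have hratio := odd_ratio_le (k := k) (M := (Fintype.card (AOWConstraint k n) : ℝ)) hn1 hq1 hX0 hX
      (by rw [← hmbar]; exact hM2) hbig hpow
    refine hfail.trans ?_
    have h4m : 4 / ((Fintype.card (AOWConstraint k n) : ℝ) * p n) ≤ 4 / n := by
      rw [← hmbar]
      exact div_le_div_of_nonneg_left (by norm_num) hn0 hmn'
    have hw : (Fintype.card (AOWConstraint k n) : ℝ) * p n /
        (((Fintype.card (AOWConstraint k n) : ℝ) * p n / 2) ^ 2 / (2 * 4 ^ k * (n : ℝ))) ≤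
        8 * 4 ^ k / Real.log n ^ 4 := by
      rw [← hmbar]
      have hlogpos : 0 < Real.log n ^ 4 := by positivity
      rw [div_div_eq_mul_div, div_le_div_iff₀ (by positivity) hlogpos]
      -- `m̄ · 2·4^k·n · (log n)^4 ≤ 8·4^k · (m̄/2)²`  ⟸  `n (log n)^4 ≤ m̄`
      have : mbar * (2 * 4 ^ k * (n : ℝ)) * Real.log n ^ 4 = 2 * 4 ^ k * mbar * ((n : ℝ) * Real.log n ^ 4) := by
        ring
      rw [this]
      have : 8 * 4 ^ k * (mbar / 2) ^ 2 = 2 * 4 ^ k * mbar * mbar := by ring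
      rw [this]
      exact mul_le_mul_of_nonneg_left hmn (by positivity)
    calc _ ≤ 4 / (n : ℝ) + 1 / n + 8 * 4 ^ k / Real.log n ^ 4 := add_le_add (add_le_add h4m hratio) hw
      _ = 5 / n + 8 * 4 ^ k / Real.log n ^ 4 := by ring
  have hlim : Tendsto (fun n : ℕ => 5 / (n : ℝ) + 8 * 4 ^ k / Real.log n ^ 4) atTop (𝓝 0) := by
    simpa using (tendsto_const_div_atTop_nhds_zero_nat 5).add (tendsto_const_div_log_pow (8 * 4 ^ k) (j := 4) (by norm_num))
  refine tendsto_of_tendsto_of_tendsto_of_le_of_le' tendsto_const_nhds hlim ?_ hev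
  exact Eventually.of_forall fun n => subsetProb_nonneg _ _

/-! ### The union bound: the refuter accepts with probability `→ 1` -/

/-- Balanced shapes have `2a ≤ k`, `1 ≤ a`, `b ≤ a`. [folklore] -/
theorem IsBalancedShape.two_mul_le {a b : ℕ} (h : IsBalancedShape k a b) : 2 * a ≤ k ∧ 1 ≤ a ∧ b ≤ a := by
  obtain ⟨h1, h2, h3, h4, h5⟩ := h
  refine ⟨?_, h3, h1⟩
  rcases Nat.eq_or_lt_of_le h2 with h | h
  · have := h5 h
    omega
  · omega

/-- An injection `[k/2 + k/2 + 1] ↪ [k]` forces `k` odd: `k = k/2 + k/2 + 1`. [folklore] -/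
theorem eq_half_add_half_add_one_of_injective {f : Fin (k / 2 + k / 2 + 1) → Fin k}
    (hf : Function.Injective f) : k = k / 2 + k / 2 + 1 := by
  have := Fintype.card_le_of_injective f hf
  simp only [Fintype.card_fin] at this
  omega

/-- **The AOW refuter accepts `F_{OR_k}(n, p(n))` with probability `→ 1`** (`k ≥ 3`) whenever
eventually `n^{k/2} (log n)^4 ≤ 2^k n^k p(n) = m̄(n)`. [Allen–O'Donnell–Witmer 2015, Thm. 2.3
(`Pr[fail] = o(1)`, Def. 3.7), `P = OR_k`, `m̄ ≥ Õ(n^{k/2})`] [cite: arXiv150504383, Thm. 2.3] -/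
theorem tendsto_subsetProb_aowAccepts (hk3 : 3 ≤ k) {p : ℕ → ℝ} (hp : ∀ n, 0 ≤ p n ∧ p n ≤ 1)
    (hH : ∀ᶠ n : ℕ in atTop, (n : ℝ) ^ ((k : ℝ) / 2) * Real.log n ^ (4 : ℝ) ≤ 2 ^ k * (n : ℝ) ^ k * p n) :
    Tendsto (fun n => subsetProb (AOWConstraint k n) (p n)
      (fun T => AOWAccepts k n (aowTraceExp k n) T.toList)) atTop (𝓝 1) := by
  classical
  -- the failure events, indexed independently of `n`
  let E : ∀ n : ℕ, (ab : Fin (k + 1) × Fin (k + 1)) → (Fin (ab.1 + ab.2) → Fin k) →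
      Finset (AOWConstraint k n) → Prop :=
    fun n ab g T => IsBalancedShape k ab.1 ab.2 ∧ Function.Injective g ∧
      ¬ LevelCheck k n (aowTraceExp k n) T.toList g
  let E' : ∀ n : ℕ, (Fin (k / 2 + k / 2 + 1) → Fin k) → Finset (AOWConstraint k n) → Prop :=
    fun n g T => Function.Injective g ∧ ¬ OddCheck k n (aowTraceExp k n) T.toList g
  -- each term tends to `0`
  have hE : ∀ (ab : Fin (k + 1) × Fin (k + 1)) (g : Fin (ab.1 + ab.2) → Fin k),
      Tendsto (fun n => subsetProb (AOWConstraint k n) (p n) (E n ab g)) atTop (𝓝 0) := by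
    intro ab g
    by_cases hsh : IsBalancedShape k ab.1 ab.2 ∧ Function.Injective g
    · obtain ⟨h2a, ha, hba⟩ := hsh.1.two_mul_le
      have h := tendsto_subsetProb_not_levelCheck g hsh.2 ha hba h2a hp hH
      refine tendsto_of_tendsto_of_tendsto_of_le_of_le' tendsto_const_nhds h
        (Eventually.of_forall fun n => subsetProb_nonneg _ _)
        (Eventually.of_forall fun n => subsetProb_mono _ fun T hT => hT.2.2)
    · have h0 : ∀ n, subsetProb (AOWConstraint k n) (p n) (E n ab g) = 0 := fun n => by
        rw [subsetProb_congr (p n) (F := fun _ => False) (fun T => ⟨fun hT => hsh ⟨hT.1, hT.2.1⟩, False.elim⟩),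
          subsetProb_false]
      simp only [h0]
      exact tendsto_const_nhds
  have hE' : ∀ g : Fin (k / 2 + k / 2 + 1) → Fin k,
      Tendsto (fun n => subsetProb (AOWConstraint k n) (p n) (E' n g)) atTop (𝓝 0) := by
    intro g
    by_cases hg : Function.Injective g
    · have hkr := eq_half_add_half_add_one_of_injective hg
      have h := tendsto_subsetProb_not_oddCheck hkr hk3 g hg hp hH
      refine tendsto_of_tendsto_of_tendsto_of_le_of_le' tendsto_const_nhds h
        (Eventually.of_forall fun n => subsetProb_nonneg _ _)
        (Eventually.of_forall fun n => subsetProb_mono _ fun T hT => hT.2)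
    · have h0 : ∀ n, subsetProb (AOWConstraint k n) (p n) (E' n g) = 0 := fun n => by
        rw [subsetProb_congr (p n) (F := fun _ => False) (fun T => ⟨fun hT => hg hT.1, False.elim⟩),
          subsetProb_false]
      simp only [h0]
      exact tendsto_const_nhds
  -- the union bound, valid for every `n`
  have hbound : ∀ n, 1 - ((∑ ab : Fin (k + 1) × Fin (k + 1), ∑ g : Fin (ab.1 + ab.2) → Fin k,
        subsetProb (AOWConstraint k n) (p n) (E n ab g)) +
      ∑ g : Fin (k / 2 + k / 2 + 1) → Fin k, subsetProb (AOWConstraint k n) (p n) (E' n g)) ≤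
      subsetProb (AOWConstraint k n) (p n) (fun T => AOWAccepts k n (aowTraceExp k n) T.toList) := by
    intro n
    obtain ⟨hp0, hp1⟩ := hp n
    have hnot : subsetProb (AOWConstraint k n) (p n)
        (fun T => ¬ AOWAccepts k n (aowTraceExp k n) T.toList) ≤
        (∑ ab : Fin (k + 1) × Fin (k + 1), ∑ g : Fin (ab.1 + ab.2) → Fin k,
          subsetProb (AOWConstraint k n) (p n) (E n ab g)) +
        ∑ g : Fin (k / 2 + k / 2 + 1) → Fin k, subsetProb (AOWConstraint k n) (p n) (E' n g) := by
      refine (subsetProb_mono (p n) (F := fun T => (∃ ab ∈ (univ : Finset (Fin (k + 1) × Fin (k + 1))),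
          ∃ g ∈ (univ : Finset (Fin (ab.1 + ab.2) → Fin k)), E n ab g T) ∨
          ∃ g ∈ (univ : Finset (Fin (k / 2 + k / 2 + 1) → Fin k)), E' n g T) ?_).trans
        ((subsetProb_or_le _ _ _).trans (add_le_add ?_ ?_))
      · intro T hT
        simp only [AOWAccepts, not_and_or, not_forall, exists_prop] at hT
        rcases hT with ⟨a', b', hsh, g, hg, hLC⟩ | ⟨g, hg, hOC⟩
        · exact Or.inl ⟨(a', b'), Finset.mem_univ _, g, Finset.mem_univ _, hsh, hg, hLC⟩
        · exact Or.inr ⟨g, Finset.mem_univ _, hg, hOC⟩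
      · refine (subsetProb_exists_le (p n) univ _).trans (Finset.sum_le_sum fun ab _ => ?_)
        exact subsetProb_exists_le (p n) univ _
      · exact subsetProb_exists_le (p n) univ _
    have hcompl := subsetProb_not hp0 hp1 (fun T => AOWAccepts k n (aowTraceExp k n) T.toList)
    linarith
  -- the sum tends to `0`
  have hsum : Tendsto (fun n => (∑ ab : Fin (k + 1) × Fin (k + 1), ∑ g : Fin (ab.1 + ab.2) → Fin k,
        subsetProb (AOWConstraint k n) (p n) (E n ab g)) +
      ∑ g : Fin (k / 2 + k / 2 + 1) → Fin k, subsetProb (AOWConstraint k n) (p n) (E' n g)) atTop (𝓝 0) := by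
    have h1 : Tendsto (fun n => ∑ ab : Fin (k + 1) × Fin (k + 1), ∑ g : Fin (ab.1 + ab.2) → Fin k,
        subsetProb (AOWConstraint k n) (p n) (E n ab g)) atTop (𝓝 0) := by
      have := tendsto_finsetSum (univ : Finset (Fin (k + 1) × Fin (k + 1)))
        (fun ab _ => tendsto_finsetSum (univ : Finset (Fin (ab.1 + ab.2) → Fin k)) (fun g _ => hE ab g))
      simpa using this
    have h2 : Tendsto (fun n => ∑ g : Fin (k / 2 + k / 2 + 1) → Fin k,
        subsetProb (AOWConstraint k n) (p n) (E' n g)) atTop (𝓝 0) := by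
      have := tendsto_finsetSum (univ : Finset (Fin (k / 2 + k / 2 + 1) → Fin k)) (fun g _ => hE' g)
      simpa using this
    simpa using h1.add h2
  refine tendsto_of_tendsto_of_tendsto_of_le_of_le' ?_ tendsto_const_nhds
    (Eventually.of_forall hbound) (Eventually.of_forall fun n => subsetProb_le_one (hp n).1 (hp n).2 _)
  simpa using hsum.const_sub 1

end Literature.Computability.Complexity
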